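import Mathlib.Algebra.Algebra.Tower
import Mathlib.LinearAlgebra.TensorProduct.Basic
import Mathlib.RepresentationTheory.Intertwining
import Mathlib.RingTheory.SimpleModule.Isotypic
import Literature.NumberTheory.Automorphic.HeckeAlgebraFixedPointsProofs
import Literature.NumberTheory.Automorphic.IrreducibleClasses
import HarnessLib

/-!
# Hecke-isotypic components (`π_f`-isotypic parts of a module over the Hecke algebra `ℋ(G, K)`)

Topic `NumberTheory/Automorphic`; definition request `defn-heckeIsotypicComponent` (route
HodgeConjecture/EndoscopicBallQuotient, crux `RationalHodgeTateTypeSupport`). Source read: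
N. Bergeron, J. Millson, C. Moeglin, *The Hodge conjecture and arithmetic quotients of complex
balls*, Acta Math. 216 (2016) = arXiv:1306.1515, Part 2, §1.8–1.9 (verbatim):

* §1.8: "Let `ℋ_K` be the Hecke algebra of `ℚ`-linear combinations of `K`-double cosets in `G(𝔸_f)`. If
  `π_f` is a representation of `G(𝔸_f)`, we let `π_f^K` denote the representation of `ℋ_K` on the space
  of `K`-fixed vectors of `π_f`. Over `ℂ`, there is an `ℋ_K`-isomorphism
  `H^•(S(K), ℂ) → ⊕_{π_f ∈ Coh_f} H^•(π_f, ℂ) ⊗ π_f^K`" (Matsushima's formula; Borel–Wallach, Ch. VII);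
* §1.9: "`W([π_f]) = ⊕_σ Hom_{G(𝔸_f)}(π_f^σ, H^•(S(K), ℚ̄)) ⊗ π_f^σ(ℚ̄)`, so that
  `H^•(S(K), ℚ̄) ≅ ⊕_{[π_f]} W([π_f])^K`"; Thm. 61 (1): "`W([π_f])^K ⊂ H^•(S(K), ℚ̄)` is a polarized
  `ℚ`-sub-Hodge structure […] the Hecke algebra `ℋ_K` acts as algebraic correspondences on `S(K)`";
* §3.5: "`SC^{2nq}(Sh(G, X))` is defined over `ℚ` and Hecke stable. We therefore have a direct sum
  decomposition into `π_f`-isotypical components".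

## What is defined (real definitions, Mathlib generality)

The notion is pure algebra once the Hecke action is given, so it is defined for ANY module over the
Hecke algebra of ANY pair `(G, K)` — the tree's `heckeAlgebra k G K = End_G(k[G ⧸ K])`
(`HeckeAlgebra`), whose OPPOSITE algebra is the double-coset convolution algebra `ℋ_K = ℋ(G, K)` and
acts on the `K`-fixed vectors `π^K = π.fixedPoints K` of every representation `π` of `G` through the
PROVED algebra map `heckeAlgebra.fixedPointsAlgHom K π : (heckeAlgebra k G K)ᵐᵒᵖ →ₐ[k] End_k(π^K)`
(`HeckeAlgebraFixedPointsProofs`; `[KgK]` acts by `∑_{yK ⊆ KgK} π(y)`).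

* `intertwiners σ ρ` — for two actions `σ : A →ₐ[k] End_k W`, `ρ : A →ₐ[k] End_k H` of a
  `k`-algebra `A` given as algebra maps (the form in which the tree records Hecke actions; no
  `Module A _` instance on a fixed carrier such as `Hⁱ(X(ℂ); ℂ)` is needed), the `k`-submodule
  `Hom_A(W, H)` of `A`-equivariant `k`-linear maps.
* `actionIsotypicComponent σ ρ : Submodule k H` — the **`σ`-isotypic component** of `(H, ρ)`: the sum
  of the images of all `A`-equivariant maps `W → H`, i.e. the image of the evaluation map
  `Hom_A(W, H) ⊗ W → H` (`range_intertwinersEval`) — exactly BMM's `Hom(π_f, H^•) ⊗ π_f → H^•`.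
* `heckeIsotypicComponent ρ π : Submodule k H` — for a Hecke module
  `ρ : (heckeAlgebra k G K)ᵐᵒᵖ →ₐ[k] End_k H` (e.g. `H = Hⁱ(X(ℂ); ℂ)` of a level-`K` locally symmetric /
  Shimura variety, `G = G(𝔸_f)` or a commensurator, acting through Hecke correspondences) and a
  representation `π` of `G` on `V`: the **`π`-isotypic component** `H[π]`, the `π^K`-isotypic
  component of `H` for the Hecke action on `π^K`. It is `⊥` when `π^K = 0`, Hecke stable, and
  depends on `π` only up to isomorphism (`heckeIsotypicComponent_congr`), whence
* `IrrClass.heckeIsotypicComponent ρ : IrrClass G → Submodule ℂ H` — the component indexed by an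
  ISOMORPHISM CLASS of irreducible smooth complex representations (the tree's `IrrClass G`,
  `IrreducibleClasses`),
  as in "`⊕_{π_f ∈ Coh_f}`".

API (all proved): membership/unfolding lemmas, Hecke/`A`-stability
(`apply_mem_actionIsotypicComponent`), functoriality in `W` along equivariant surjections and
isomorphisms, vanishing for `W = 0` / `π^K = 0`, `range_intertwinersEval`, and the naturality of
`fixedPointsAlgHom` under intertwining maps of representations (`heckeAlgebra.fixedPointsMap`,
`coe_fixedPointsAlgHom_fixedPointsMap`), which drives `heckeIsotypicComponent_congr`.

## Mathlib and the tree

Mathlib's `isotypicComponent R M S = sSup {m | Nonempty (m ≃ₗ[R] S)}`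
(`RingTheory/SimpleModule/Isotypic`) needs `Module R M` INSTANCES on both carriers and is phrased by
sub-modules isomorphic to `S`; for `S` simple it agrees with the sum of images of `R`-maps `S → M`
used here (every non-zero map from a simple module is injective). The Hom/evaluation form is the
printed one (BMM §1.9) and is what a FIXED carrier with an action given as DATA requires. Mathlib's
`Representation.IntertwiningMap` / `Representation.Equiv` are used for maps of `G`-representations.
Not here (separate requests): the Hecke action of `ℋ(U(V)(𝔸_{F,f}), K)` on `Hⁱ(X(ℂ); ℂ)` of a ball
quotient through Hecke correspondences (needs `UnitaryBallQuotientDatum`, filed separately; the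
hypothesis-structure shape is `HodgeTheory.CorrespondenceAction`), Matsushima's formula itself, the
`Aut(ℂ)`-conjugates `π_f^σ`, and the weak base change `Ψ(π)` to `GL_N/E` (no unitary groups in the
tree yet).

## References

* [BergeronMillsonMoeglin2016Balls] N. Bergeron, J. Millson, C. Moeglin, Acta Math. 216 (2016),
  arXiv:1306.1515, Part 2 §1.8 (eq. "Mdec"), §1.9, Thm. 61, §3.5.
* [BorelWallach2000] A. Borel, N. Wallach, *Continuous cohomology, discrete subgroups, and
  representations of reductive groups*, 2nd ed., Ch. VII (Matsushima's formula).
* [Cartier1979] P. Cartier, *Representations of p-adic groups: a survey*, Corvallis, §IV.1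
  (`ℋ(G, K)`-module `V^K`).
-/

noncomputable section

open MonoidAlgebra TensorProduct

namespace Literature.NumberTheory.Automorphic

/-! ### Intertwiners and isotypic components for actions given by algebra maps -/

section Action

variable {k : Type*} [CommSemiring k] {A : Type*} [Semiring A] [Algebra k A]
  {W : Type*} [AddCommMonoid W] [Module k W]
  {W' : Type*} [AddCommMonoid W'] [Module k W']
  {H : Type*} [AddCommMonoid H] [Module k H]
  {H' : Type*} [AddCommMonoid H'] [Module k H']

/-- The `k`-module `Hom_A(W, H)` of **intertwiners** (`A`-equivariant `k`-linear maps) between two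
`A`-actions given as `k`-algebra maps `σ : A → End_k W`, `ρ : A → End_k H`:
`f ∘ σ(a) = ρ(a) ∘ f` for all `a`. (BMM write `Hom_{G(𝔸_f)}(π_f, H^•(S(K)))`.)
[cite: BergeronMillsonMoeglin2016Balls, Part 2 §1.9] -/
def intertwiners (σ : A →ₐ[k] Module.End k W) (ρ : A →ₐ[k] Module.End k H) :
    Submodule k (W →ₗ[k] H) where
  carrier := {f | ∀ a : A, f ∘ₗ σ a = ρ a ∘ₗ f}
  zero_mem' a := by simp
  add_mem' {f g} hf hg a := by rw [LinearMap.add_comp, LinearMap.comp_add, hf a, hg a]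
  smul_mem' c f hf a := by rw [LinearMap.smul_comp, LinearMap.comp_smul, hf a]

variable {σ : A →ₐ[k] Module.End k W} {τ : A →ₐ[k] Module.End k W'}
  {ρ : A →ₐ[k] Module.End k H} {ρ' : A →ₐ[k] Module.End k H'}

/-- Membership in `intertwiners`: `f ∘ σ(a) = ρ(a) ∘ f` for all `a`. [folklore] -/
theorem mem_intertwiners_iff (f : W →ₗ[k] H) :
    f ∈ intertwiners σ ρ ↔ ∀ a : A, f ∘ₗ σ a = ρ a ∘ₗ f :=
  Iff.rfl

/-- Membership in `intertwiners`, pointwise: `f (σ(a) w) = ρ(a) (f w)`. [folklore] -/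
theorem mem_intertwiners_iff' (f : W →ₗ[k] H) :
    f ∈ intertwiners σ ρ ↔ ∀ (a : A) (w : W), f (σ a w) = ρ a (f w) := by
  simp only [mem_intertwiners_iff, LinearMap.ext_iff, LinearMap.comp_apply]

/-- Intertwiners compose: `Hom_A(W, H) ∘ Hom_A(W', W) ⊆ Hom_A(W', H)`. [folklore] -/
theorem comp_mem_intertwiners {f : W →ₗ[k] H} (hf : f ∈ intertwiners σ ρ) {g : W' →ₗ[k] W}
    (hg : g ∈ intertwiners τ σ) : f ∘ₗ g ∈ intertwiners τ ρ := fun a => by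
  rw [LinearMap.comp_assoc, hg a, ← LinearMap.comp_assoc, hf a, LinearMap.comp_assoc]

/-- The inverse of an equivariant linear isomorphism is equivariant. [folklore] -/
theorem symm_mem_intertwiners {e : W ≃ₗ[k] W'} (he : (e : W →ₗ[k] W') ∈ intertwiners σ τ) :
    (e.symm : W' →ₗ[k] W) ∈ intertwiners τ σ := fun a => by
  rw [mem_intertwiners_iff] at he
  refine LinearMap.ext fun w' => ?_
  simp only [LinearMap.comp_apply, LinearEquiv.coe_coe]
  apply e.injective
  have := LinearMap.congr_fun (he a) (e.symm w')
  simp only [LinearMap.comp_apply, LinearEquiv.coe_coe, LinearEquiv.apply_symm_apply] at this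
  rw [LinearEquiv.apply_symm_apply, this]

variable (σ ρ) in
/-- The **`σ`-isotypic component** of the `A`-action `ρ` on `H`: the sum of the images of all
`A`-equivariant `k`-linear maps `W → H`, i.e. the image of the evaluation map `Hom_A(W, H) ⊗ W → H`
(`range_intertwinersEval`). For `W = π_f^K` simple this is the `π_f`-isotypical component of BMM.
[cite: BergeronMillsonMoeglin2016Balls, Part 2 §1.9 and §3.5] -/
def actionIsotypicComponent : Submodule k H :=
  ⨆ f : intertwiners σ ρ, LinearMap.range (f : W →ₗ[k] H)

/-- Unfolding `actionIsotypicComponent`. [folklore] -/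
theorem actionIsotypicComponent_def :
    actionIsotypicComponent σ ρ = ⨆ f : intertwiners σ ρ, LinearMap.range (f : W →ₗ[k] H) :=
  rfl

/-- The image of every intertwiner lies in the isotypic component. [folklore] -/
theorem range_le_actionIsotypicComponent {f : W →ₗ[k] H} (hf : f ∈ intertwiners σ ρ) :
    LinearMap.range f ≤ actionIsotypicComponent σ ρ :=
  le_iSup (fun f : intertwiners σ ρ => LinearMap.range (f : W →ₗ[k] H)) ⟨f, hf⟩

/-- Values of intertwiners lie in the isotypic component. [folklore] -/
theorem apply_mem_actionIsotypicComponent_of_mem_intertwiners {f : W →ₗ[k] H}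
    (hf : f ∈ intertwiners σ ρ) (w : W) : f w ∈ actionIsotypicComponent σ ρ :=
  range_le_actionIsotypicComponent hf (LinearMap.mem_range_self f w)

/-- The isotypic component is the LEAST submodule containing the images of all intertwiners.
[folklore] -/
theorem actionIsotypicComponent_le_iff {N : Submodule k H} :
    actionIsotypicComponent σ ρ ≤ N ↔ ∀ f ∈ intertwiners σ ρ, LinearMap.range f ≤ N := by
  rw [actionIsotypicComponent, iSup_le_iff, Subtype.forall]

/-- Membership: `x ∈ H[σ]` iff `x` is a finite sum `∑ fᵢ(wᵢ)` of values of intertwiners. [folklore] -/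
theorem mem_actionIsotypicComponent_iff (x : H) :
    x ∈ actionIsotypicComponent σ ρ ↔
      ∃ (s : Finset (intertwiners σ ρ)) (w : intertwiners σ ρ → W),
        x = ∑ f ∈ s, (f : W →ₗ[k] H) (w f) := by
  constructor
  · intro hx
    rw [actionIsotypicComponent, Submodule.mem_iSup_iff_exists_finsupp] at hx
    obtain ⟨c, hc, rfl⟩ := hx
    choose w hw using fun f => LinearMap.mem_range.1 (hc f)
    exact ⟨c.support, w, Finset.sum_congr rfl fun f _ => (hw f).symm⟩
  · rintro ⟨s, w, rfl⟩
    exact Submodule.sum_mem _ fun f _ =>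
      apply_mem_actionIsotypicComponent_of_mem_intertwiners f.2 (w f)

/-- **Stability.** The isotypic component is stable under the action: `ρ(a) H[σ] ⊆ H[σ]`
(`ρ(a) ∘ f = f ∘ σ(a)` has image inside that of `f`). [folklore] -/
theorem map_actionIsotypicComponent_le (a : A) :
    (actionIsotypicComponent σ ρ).map (ρ a) ≤ actionIsotypicComponent σ ρ := by
  rw [actionIsotypicComponent, Submodule.map_iSup]
  refine iSup_le fun f => ?_
  rw [← LinearMap.range_comp, ← f.2 a]
  exact (LinearMap.range_comp_le_range _ _).trans (range_le_actionIsotypicComponent f.2)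

/-- **Stability**, pointwise: `x ∈ H[σ] → ρ(a) x ∈ H[σ]`. [folklore] -/
theorem apply_mem_actionIsotypicComponent (a : A) {x : H} (hx : x ∈ actionIsotypicComponent σ ρ) :
    ρ a x ∈ actionIsotypicComponent σ ρ :=
  map_actionIsotypicComponent_le a (Submodule.mem_map_of_mem hx)

/-- **Functoriality in `W`.** An equivariant SURJECTION `g : W' ↠ W` gives `H[σ] ⊆ H[τ]`
(`range f = range (f ∘ g)`). [folklore] -/
theorem actionIsotypicComponent_le_of_surjective {g : W' →ₗ[k] W} (hg : g ∈ intertwiners τ σ)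
    (hs : Function.Surjective g) : actionIsotypicComponent σ ρ ≤ actionIsotypicComponent τ ρ := by
  rw [actionIsotypicComponent_le_iff]
  intro f hf
  rw [← LinearMap.range_comp_of_range_eq_top (f := g) f (LinearMap.range_eq_top.2 hs)]
  exact range_le_actionIsotypicComponent (comp_mem_intertwiners hf hg)

/-- **Isomorphism invariance.** Equivariantly isomorphic `W ≅ W'` have the same isotypic component
in every `H` (so the component is indexed by isomorphism classes). [folklore] -/
theorem actionIsotypicComponent_eq_of_linearEquiv (e : W ≃ₗ[k] W')
    (he : (e : W →ₗ[k] W') ∈ intertwiners σ τ) :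
    actionIsotypicComponent σ ρ = actionIsotypicComponent τ ρ :=
  le_antisymm (actionIsotypicComponent_le_of_surjective (symm_mem_intertwiners he) e.symm.surjective)
    (actionIsotypicComponent_le_of_surjective he e.surjective)

/-- **Functoriality in `H`.** An equivariant map `u : H → H'` maps `H[σ]` into `H'[σ]`. [folklore] -/
theorem map_actionIsotypicComponent_le_of_mem_intertwiners {u : H →ₗ[k] H'}
    (hu : u ∈ intertwiners ρ ρ') :
    (actionIsotypicComponent σ ρ).map u ≤ actionIsotypicComponent σ ρ' := by
  rw [actionIsotypicComponent, Submodule.map_iSup]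
  refine iSup_le fun f => ?_
  rw [← LinearMap.range_comp]
  exact range_le_actionIsotypicComponent (comp_mem_intertwiners hu f.2)

/-- `W` is its own `σ`-isotypic component (the identity is an intertwiner). [folklore] -/
theorem actionIsotypicComponent_self : actionIsotypicComponent σ σ = ⊤ :=
  top_le_iff.1 fun w _ =>
    apply_mem_actionIsotypicComponent_of_mem_intertwiners (f := LinearMap.id) (fun _ => rfl) w

/-- The isotypic component of the zero module is `⊥`. [folklore] -/
theorem actionIsotypicComponent_eq_bot [Subsingleton W] : actionIsotypicComponent σ ρ = ⊥ := by
  rw [eq_bot_iff, actionIsotypicComponent_le_iff]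
  intro f _
  rw [le_bot_iff, LinearMap.range_eq_bot]
  exact LinearMap.ext fun w => by rw [Subsingleton.elim w 0, map_zero, LinearMap.zero_apply]

variable (σ ρ) in
/-- The **evaluation map** `Hom_A(W, H) ⊗_k W → H`, `f ⊗ w ↦ f w` (BMM's map
`Hom(π_f, H^•) ⊗ π_f → H^•` of §1.9 / (Mdec)). [cite: BergeronMillsonMoeglin2016Balls, Part 2 §1.9] -/
def intertwinersEval : intertwiners σ ρ ⊗[k] W →ₗ[k] H :=
  TensorProduct.lift (intertwiners σ ρ).subtype

/-- `intertwinersEval (f ⊗ w) = f w`. [folklore] -/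
@[simp] theorem intertwinersEval_tmul (f : intertwiners σ ρ) (w : W) :
    intertwinersEval σ ρ (f ⊗ₜ w) = (f : W →ₗ[k] H) w :=
  TensorProduct.lift.tmul _ _

/-- **The isotypic component is the image of the evaluation map** `Hom_A(W, H) ⊗ W → H`.
[cite: BergeronMillsonMoeglin2016Balls, Part 2 §1.9] -/
theorem range_intertwinersEval :
    LinearMap.range (intertwinersEval σ ρ) = actionIsotypicComponent σ ρ := by
  refine le_antisymm ?_ ?_
  · rw [LinearMap.range_eq_map, ← TensorProduct.span_tmul_eq_top, Submodule.map_span,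
      Submodule.span_le]
    rintro _ ⟨_, ⟨f, w, rfl⟩, rfl⟩
    rw [SetLike.mem_coe, intertwinersEval_tmul]
    exact apply_mem_actionIsotypicComponent_of_mem_intertwiners f.2 w
  · rw [actionIsotypicComponent_le_iff]
    rintro f hf _ ⟨w, rfl⟩
    exact ⟨(⟨f, hf⟩ : intertwiners σ ρ) ⊗ₜ w, intertwinersEval_tmul _ _⟩

end Action

/-! ### Comparison with Mathlib's `isotypicComponent` (genuine module structures, simple type) -/

section MathlibComparison

variable {k : Type*} [CommRing k] {A : Type*} [Ring A] [Algebra k A]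
  {W : Type*} [AddCommGroup W] [Module k W] [Module A W] [IsScalarTower k A W]
  {H : Type*} [AddCommGroup H] [Module k H] [Module A H] [IsScalarTower k A H]

/-- When the actions ARE module structures (`σ = ρ = Algebra.lsmul`, i.e. `a ↦ (a • ·)`), the
intertwiners are exactly the `A`-linear maps. [folklore] -/
theorem mem_intertwiners_lsmul_iff (f : W →ₗ[k] H) :
    f ∈ intertwiners (Algebra.lsmul k (A := A) k W) (Algebra.lsmul k (A := A) k H) ↔
      ∀ (a : A) (w : W), f (a • w) = a • f w := by
  rw [mem_intertwiners_iff']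
  rfl

/-- An `A`-linear map, with scalars restricted to `k`, is an intertwiner for `Algebra.lsmul`.
[folklore] -/
theorem restrictScalars_mem_intertwiners (f : W →ₗ[A] H) :
    (f.restrictScalars k : W →ₗ[k] H) ∈ intertwiners (Algebra.lsmul k (A := A) k W) (Algebra.lsmul k (A := A) k H) :=
  (mem_intertwiners_lsmul_iff _).2 fun a w => f.map_smul a w

/-- The `A`-linear map underlying an intertwiner for `Algebra.lsmul`. [folklore] -/
def linearMapOfMemIntertwiners (f : W →ₗ[k] H)
    (hf : f ∈ intertwiners (Algebra.lsmul k (A := A) k W) (Algebra.lsmul k (A := A) k H)) : W →ₗ[A] H where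
  toFun := f
  map_add' := f.map_add
  map_smul' a w := (mem_intertwiners_lsmul_iff f).1 hf a w

/-- Unfolding `linearMapOfMemIntertwiners`. [folklore] -/
@[simp] theorem linearMapOfMemIntertwiners_apply (f : W →ₗ[k] H)
    (hf : f ∈ intertwiners (Algebra.lsmul k (A := A) k W) (Algebra.lsmul k (A := A) k H)) (w : W) :
    linearMapOfMemIntertwiners f hf w = f w :=
  rfl

/-- **Agreement with Mathlib.** For genuine `A`-modules and a SIMPLE `A`-module `W`, the
`W`-isotypic component in the Hom/evaluation form used here (sum of the images of all `A`-linear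
maps `W → H`) is Mathlib's `isotypicComponent A H W = sSup {m | m ≃ₗ[A] W}` (sum of all submodules
isomorphic to `W`): a non-zero `A`-map out of a simple module is injective (Schur), so its image is
isomorphic to `W`, and conversely every `m ≅ W` is such an image. [folklore] -/
theorem actionIsotypicComponent_lsmul_eq_restrictScalars_isotypicComponent [IsSimpleModule A W] :
    actionIsotypicComponent (Algebra.lsmul k (A := A) k W) (Algebra.lsmul k (A := A) k H) =
      (isotypicComponent A H W).restrictScalars k := by
  apply le_antisymm
  · rw [actionIsotypicComponent_le_iff]
    intro f hf
    rcases (linearMapOfMemIntertwiners f hf).injective_or_eq_zero with hinj | h0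
    · have hle : LinearMap.range (linearMapOfMemIntertwiners f hf) ≤ isotypicComponent A H W :=
        le_sSup ⟨(LinearEquiv.ofInjective _ hinj).symm⟩
      rintro _ ⟨w, rfl⟩
      exact hle ⟨w, rfl⟩
    · have hf0 : f = 0 := LinearMap.ext fun w => LinearMap.congr_fun h0 w
      rw [hf0, LinearMap.range_zero]
      exact bot_le
  · let C : Submodule A H :=
      { toAddSubmonoid :=
          (actionIsotypicComponent (Algebra.lsmul k (A := A) k W) (Algebra.lsmul k (A := A) k H)).toAddSubmonoid
        smul_mem' := fun a x hx =>
          apply_mem_actionIsotypicComponent (σ := Algebra.lsmul k (A := A) k W) (ρ := Algebra.lsmul k (A := A) k H)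
            a hx }
    have key : isotypicComponent A H W ≤ C := by
      refine sSup_le fun m hm => ?_
      obtain ⟨e⟩ := hm
      intro x hx
      have hx' : x = (m.subtype ∘ₗ (e.symm : W →ₗ[A] m)).restrictScalars k (e ⟨x, hx⟩) := by
        simp
      rw [hx']
      exact apply_mem_actionIsotypicComponent_of_mem_intertwiners
        (restrictScalars_mem_intertwiners _) _
    exact fun x hx => key hx

end MathlibComparison

/-! ### Naturality of the Hecke action on fixed vectors -/

namespace heckeAlgebra

section Naturality

variable {k : Type*} [CommRing k] {G : Type*} [Group G] (K : Subgroup G)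
  {V : Type*} [AddCommGroup V] [Module k V] {V' : Type*} [AddCommGroup V'] [Module k V']
  {π : Representation k G V} {π' : Representation k G V'}

/-- `Φ` is natural: an intertwining map `u : π → π'` satisfies `u (Φ_π(f) v) = Φ_{π'}(f) (u v)` for
every `f ∈ k[G ⧸ K]` (same representatives on both sides). [folklore] -/
theorem map_liftRep_apply (u : π.IntertwiningMap π') (f : MonoidAlgebra k (G ⧸ K)) (v : V) :
    u (liftRep K π f v) = liftRep K π' f (u v) := by
  induction f using MonoidAlgebra.induction_linear with
  | zero => simp
  | add x y hx hy => simp [map_add, hx, hy]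
  | single y r =>
    rw [liftRep_single, liftRep_single, LinearMap.smul_apply, LinearMap.smul_apply, map_smul,
      u.isIntertwining]

/-- An intertwining map `u : π → π'` restricts to the `K`-fixed vectors, `u^K : π^K → π'^K`.
[folklore] -/
def fixedPointsMap (u : π.IntertwiningMap π') : π.fixedPoints K →ₗ[k] π'.fixedPoints K :=
  (u.toLinearMap.comp (π.fixedPoints K).subtype).codRestrict (π'.fixedPoints K) fun v => by
    rw [Representation.mem_fixedPoints]
    intro g hg
    change π' g (u (v : V)) = u (v : V)
    rw [← u.isIntertwining, (Representation.mem_fixedPoints π K (v : V)).1 v.2 g hg]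

/-- Unfolding `fixedPointsMap`: `(u^K v : V') = u v`. [folklore] -/
@[simp] theorem coe_fixedPointsMap_apply (u : π.IntertwiningMap π') (v : π.fixedPoints K) :
    (fixedPointsMap K u v : V') = u (v : V) :=
  rfl

/-- An isomorphism of representations restricts to a SURJECTION on `K`-fixed vectors. [folklore] -/
theorem fixedPointsMap_surjective (e : π.Equiv π') :
    Function.Surjective (fixedPointsMap K e.toIntertwiningMap) := by
  intro v'
  refine ⟨⟨e.symm (v' : V'), ?_⟩, Subtype.ext ?_⟩
  · have h := (fixedPointsMap K e.symm.toIntertwiningMap v').2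
    simpa using h
  · simp

/-- **Naturality of the Hecke action.** `u^K` intertwines the `ℋ(G, K)ᵐᵒᵖ`-actions on `π^K` and
`π'^K`: `u (v · T) = (u v) · T` (both are `Φ(T [K])`, natural in the representation).
(Cartier 1979, §IV.1: `V ↦ V^K` is a functor to `ℋ(G, K)`-modules.) [cite: Cartier1979, §IV.1] -/
theorem coe_fixedPointsAlgHom_fixedPointsMap (u : π.IntertwiningMap π')
    (T : (heckeAlgebra k G K)ᵐᵒᵖ) (v : π.fixedPoints K) :
    (fixedPointsAlgHom K π' T (fixedPointsMap K u v) : V') = u (fixedPointsAlgHom K π T v : V) := by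
  induction T using MulOpposite.rec' with
  | h T => rw [coe_fixedPointsAlgHom_apply, coe_fixedPointsAlgHom_apply, coe_fixedPointsMap_apply,
      map_liftRep_apply]

/-- `u^K ∈ Hom_{ℋ(G,K)ᵐᵒᵖ}(π^K, π'^K)`. [cite: Cartier1979, §IV.1] -/
theorem fixedPointsMap_mem_intertwiners (u : π.IntertwiningMap π') :
    fixedPointsMap K u ∈ intertwiners (fixedPointsAlgHom K π) (fixedPointsAlgHom K π') := by
  rw [mem_intertwiners_iff']
  intro T v
  exact Subtype.ext (coe_fixedPointsAlgHom_fixedPointsMap K u T v).symm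

end Naturality

end heckeAlgebra

/-! ### Hecke-isotypic components -/

section Hecke

variable {k : Type*} [CommRing k] {G : Type*} [Group G] {K : Subgroup G}
  {H : Type*} [AddCommGroup H] [Module k H]
  (ρ : (heckeAlgebra k G K)ᵐᵒᵖ →ₐ[k] Module.End k H)
  {V : Type*} [AddCommGroup V] [Module k V] (π : Representation k G V)
  {V' : Type*} [AddCommGroup V'] [Module k V'] {π' : Representation k G V'}

/-- The **`π`-isotypic (Hecke-isotypic) component** `H[π]` of a module `H` over the Hecke algebra of
the pair `(G, K)` — `ρ : ℋ(G, K) = (heckeAlgebra k G K)ᵐᵒᵖ → End_k H`, e.g. `H = Hⁱ(S(K), ℂ)` with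
`ℋ_K` acting through Hecke correspondences — attached to a representation `π` of `G`: the sum of the
images of all `ℋ(G, K)`-equivariant maps `π^K → H`, where `π^K = π.fixedPoints K` carries the Hecke
action `heckeAlgebra.fixedPointsAlgHom K π` ("`π_f^K` denote[s] the representation of `ℋ_K` on the
space of `K`-fixed vectors of `π_f`"); equivalently the image of `Hom_{ℋ_K}(π^K, H) ⊗ π^K → H`
(`range_intertwinersEval`). For `H = H^•(S(K), ℂ)` and `π = π_f ∈ Coh_f` this is the summand
`H^•(π_f, ℂ) ⊗ π_f^K` of Matsushima's decomposition, BMM (Mdec).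
[cite: BergeronMillsonMoeglin2016Balls, Part 2 §1.8–1.9] -/
def heckeIsotypicComponent : Submodule k H :=
  actionIsotypicComponent (heckeAlgebra.fixedPointsAlgHom K π) ρ

/-- Unfolding `heckeIsotypicComponent`. [folklore] -/
theorem heckeIsotypicComponent_def :
    heckeIsotypicComponent ρ π =
      ⨆ f : intertwiners (heckeAlgebra.fixedPointsAlgHom K π) ρ,
        LinearMap.range (f : π.fixedPoints K →ₗ[k] H) :=
  rfl

/-- The image of every Hecke-equivariant map `π^K → H` lies in `H[π]`. [folklore] -/
theorem range_le_heckeIsotypicComponent {f : π.fixedPoints K →ₗ[k] H}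
    (hf : f ∈ intertwiners (heckeAlgebra.fixedPointsAlgHom K π) ρ) :
    LinearMap.range f ≤ heckeIsotypicComponent ρ π :=
  range_le_actionIsotypicComponent hf

/-- **`H[π]` is Hecke stable**: `ρ(T) H[π] ⊆ H[π]` ("Hecke stable. We therefore have a direct sum
decomposition into `π_f`-isotypical components"). [cite: BergeronMillsonMoeglin2016Balls, Part 2 §3.5] -/
theorem apply_mem_heckeIsotypicComponent (T : (heckeAlgebra k G K)ᵐᵒᵖ) {x : H}
    (hx : x ∈ heckeIsotypicComponent ρ π) : ρ T x ∈ heckeIsotypicComponent ρ π :=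
  apply_mem_actionIsotypicComponent T hx

/-- `π^K` is its own `π`-isotypic component (non-vacuity: `H[π] = ⊤ ≠ ⊥` for `H = π^K ≠ 0`).
[folklore] -/
theorem heckeIsotypicComponent_self :
    heckeIsotypicComponent (heckeAlgebra.fixedPointsAlgHom K π) π = ⊤ :=
  actionIsotypicComponent_self

/-- Only representations with `π^K ≠ 0` contribute: if `π^K = 0` then `H[π] = 0`. [folklore] -/
theorem heckeIsotypicComponent_eq_bot (h : π.fixedPoints K = ⊥) :
    heckeIsotypicComponent ρ π = ⊥ := by
  haveI : Subsingleton (π.fixedPoints K) := by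
    rw [h]
    infer_instance
  exact actionIsotypicComponent_eq_bot

variable {π} in
/-- **Functoriality.** If an intertwining map `u : π → π'` is surjective on `K`-fixed vectors
(`u^K : π^K ↠ π'^K`; automatic for isomorphisms, `fixedPointsMap_surjective`), then
`H[π'] ≤ H[π]` (every Hecke map out of `π'^K` pulls back to one out of `π^K` with the same image).
[folklore] -/
theorem heckeIsotypicComponent_le_of_surjective (u : π.IntertwiningMap π')
    (hu : Function.Surjective (heckeAlgebra.fixedPointsMap K u)) :
    heckeIsotypicComponent ρ π' ≤ heckeIsotypicComponent ρ π :=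
  actionIsotypicComponent_le_of_surjective (heckeAlgebra.fixedPointsMap_mem_intertwiners K u) hu

variable {π} in
/-- **Isomorphism invariance**: isomorphic representations have the same isotypic component, so
`H[π]` is indexed by isomorphism classes `[π]`. [cite: BergeronMillsonMoeglin2016Balls, Part 2 §1.9] -/
theorem heckeIsotypicComponent_congr (e : π.Equiv π') :
    heckeIsotypicComponent ρ π = heckeIsotypicComponent ρ π' :=
  le_antisymm
    (heckeIsotypicComponent_le_of_surjective ρ e.symm.toIntertwiningMap
      (heckeAlgebra.fixedPointsMap_surjective K e.symm))
    (heckeIsotypicComponent_le_of_surjective ρ e.toIntertwiningMap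
      (heckeAlgebra.fixedPointsMap_surjective K e))

end Hecke

/-! ### Indexing by isomorphism classes of irreducible smooth representations -/

namespace IrrClass

variable {G : Type*} [Group G] [TopologicalSpace G] {K : Subgroup G}
  {H : Type*} [AddCommGroup H] [Module ℂ H]
  (ρ : (heckeAlgebra ℂ G K)ᵐᵒᵖ →ₐ[ℂ] Module.End ℂ H)

/-- The Hecke-isotypic component `H[π_f]` indexed by an **isomorphism class** `[π_f] ∈ Irr(G)` of
irreducible smooth complex representations of `G` (the tree's `IrrClass G`); well defined
by `heckeIsotypicComponent_congr`. For `G = G(𝔸_f)`, `H = H^•(S(K), ℂ)` these are the summands of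
`H^•(S(K), ℂ) ≅ ⊕_{π_f ∈ Coh_f} H^•(π_f, ℂ) ⊗ π_f^K`.
[cite: BergeronMillsonMoeglin2016Balls, Part 2 §1.8–1.9] -/
def heckeIsotypicComponent : IrrClass G → Submodule ℂ H :=
  Quotient.lift (fun r : SmoothIrrep G => Automorphic.heckeIsotypicComponent ρ r.ρ)
    fun _ _ h => h.elim fun e => heckeIsotypicComponent_congr ρ e

/-- Computation rule on a class `[r]`. [folklore] -/
@[simp] theorem heckeIsotypicComponent_mk (r : SmoothIrrep G) :
    heckeIsotypicComponent ρ (IrrClass.mk r) = Automorphic.heckeIsotypicComponent ρ r.ρ :=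
  rfl

/-- `H[[π_f]]` is Hecke stable. [cite: BergeronMillsonMoeglin2016Balls, Part 2 §3.5] -/
theorem apply_mem_heckeIsotypicComponent (c : IrrClass G) (T : (heckeAlgebra ℂ G K)ᵐᵒᵖ) {x : H}
    (hx : x ∈ heckeIsotypicComponent ρ c) : ρ T x ∈ heckeIsotypicComponent ρ c := by
  induction c using IrrClass.ind with
  | h r => exact Automorphic.apply_mem_heckeIsotypicComponent ρ r.ρ T hx

end IrrClass

end Literature.NumberTheory.Automorphic

end
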